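import Literature.NumberTheory.Automorphic.HeckeAlgebra
import HarnessLib

/-!
# Gelfand pairs from an anti-involution: commutativity of `ℋ(G, K) = End_G(k[G ⧸ K])`

Topic `NumberTheory/Automorphic`; a theorems-only complement to `HeckeAlgebra` (the Hecke algebra
`heckeAlgebra k G K = End_G(k[G ⧸ K])` of a pair `(G, K)` — the commutant of the permutation
representation `Representation.ofMulAction k G (G ⧸ K)` on the free module `k[G ⧸ K]` — and the
predicate `IsGelfandPair k G K`: "`ℋ(G, K)` is commutative") and to `HeckeGelfandTrick` (the same
trick for the concrete Hecke operators `heckeOperator ρ K g` on the `K`-fixed vectors of a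
representation).

**Gelfand's trick** (`IsGelfandPair.of_antiInvolution`; Bump, *Automorphic Forms and
Representations* (1997), Thm. 4.6.1 and proof of Thm. 3.3.3; Getz–Hahn, *An Introduction to
Automorphic Representations* (2024), Thm. 5.5.1 with Exercise 5.14; Cartier, *Representations of
𝔭-adic groups: a survey*, Corvallis 1979, §IV.1): let `t` be an anti-involution of the group `G`
(packaged as `τ : G ≃* Gᵐᵒᵖ`, `t = unop ∘ τ`, with `t ∘ t = id`) such that `t(K) ⊆ K` and
`t g ∈ K g K` for every `g ∈ G`.  Then `ℋ(G, K)` is commutative, over every commutative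
coefficient ring `k`.  With `G = GL_n(F)`, `K = GL_n(𝒪_F)` and `t` the transpose (the double-coset
condition being the Cartan decomposition) this yields the Gelfand pair `(GL_n(F), GL_n(𝒪_F))`
(module `SatakeParametersGLGelfandPairProofs`).

## The argument (all proved; no finiteness hypothesis on double cosets is needed)

An endomorphism `T` of `k[G ⧸ K]` has matrix coefficients `T_{x,y}` = coefficient of `[x]` in
`T [y]` (`x, y ∈ G ⧸ K`; in Lean `(T (MonoidAlgebra.single y 1)).coeff x`), with
`(T f)_x = ∑_y f_y T_{x,y}` (`coeff_apply_eq_finsum_coeff_apply_single`) and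
`(T S)_{x,z} = ∑_y S_{y,z} T_{x,y}` (`coeff_mul_apply_single_eq_finsum`), finite sums.  For
`T ∈ ℋ(G, K)` the kernel is `G`-invariant, `T_{gx,gy} = T_{x,y}`
(`coeff_apply_single_smul_of_mem_heckeAlgebra`), so `T_{[a],[b]} = φ_T(a⁻¹ b)` for the
bi-`K`-invariant function `φ_T(g) = T_{[1],[g]}` on `G` (`coeff_apply_single_mk_of_mem_heckeAlgebra`,
`coeff_apply_single_mul_mul_of_mem_heckeAlgebra`).  The double-coset hypothesis gives
`φ_T ∘ t = φ_T`, i.e. `T_{[a],[b]} = T_{[σ b],[σ a]}` for the automorphism `σ = (t ·)⁻¹` of `G`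
(`coeff_apply_single_eq_of_antiInvolution`); `σ` is an involution with `σ(K) = K`, so it induces an
involution of `G ⧸ K`, and reindexing the sum over `G ⧸ K` along it gives
`(TS)_{[a],[c]} = ∑_y S_{y,[c]} T_{[a],y} = ∑_y T_{σy,[σa]} S_{[σc],σy} = (ST)_{[σc],[σa]} = (ST)_{[a],[c]}`.
This is the classical proof (`ᵗ(φ₁ * φ₂) = ᵗφ₂ * ᵗφ₁` and `ᵗφ = φ` on `ℋ(G, K)`, Bump, loc. cit.)
written for the model `End_G(k[G ⧸ K])` of module `HeckeAlgebra`, which is anti-isomorphic to the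
convolution algebra of bi-`K`-invariant functions.

## Design notes

* No auxiliary definition is introduced (the coefficients are written out), so that the file is
  theorems-only; hypotheses on `τ` are stated elementwise exactly as in
  `HeckeGelfandTrick.heckeOperator_comm_apply_of_antiInvolution`.
* Nothing here is specific to `GL_n`; the transpose and the Cartan decomposition live in
  `CartanDecompositionGLn` and `SatakeParametersGLGelfandPairProofs`.

## References

* D. Bump, *Automorphic Forms and Representations*, Cambridge Stud. Adv. Math. 55 (1997),
  Thm. 4.6.1 and proof of Thm. 3.3.3 [Bump1997].
* J. R. Getz, H. Hahn, *An Introduction to Automorphic Representations*, GTM 300 (2024),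
  Thm. 5.5.1, Exercise 5.14 [GetzHahn2024].
* P. Cartier, *Representations of 𝔭-adic groups: a survey*, Proc. Sympos. Pure Math. 33 (1979),
  part 1, §IV.1 [CartierCorvallis1979].
-/

namespace Literature.NumberTheory.Automorphic

section GelfandPair

variable {k G : Type*} [CommRing k] [Group G] (K : Subgroup G)

/-- **Expansion along the coset basis.** For a `k`-linear endomorphism `T` of `k[G ⧸ K]` and
`f ∈ k[G ⧸ K]`, the coefficient of `[x]` in `T f` is `∑_y f_y · T_{x,y}`, where
`T_{x,y}` is the coefficient of `[x]` in `T [y]` (a finite sum: `f` is finitely supported).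
[folklore] -/
theorem coeff_apply_eq_finsum_coeff_apply_single (T : Module.End k (MonoidAlgebra k (G ⧸ K)))
    (f : MonoidAlgebra k (G ⧸ K)) (x : G ⧸ K) :
    (T f).coeff x = ∑ᶠ y, f.coeff y * (T (MonoidAlgebra.single y 1)).coeff x := by
  classical
  have h1 : T f = f.coeff.sum fun y c => c • T (MonoidAlgebra.single y 1) := by
    conv_lhs => rw [← MonoidAlgebra.sum_coeff_single f, map_finsuppSum]
    refine Finsupp.sum_congr fun y _ => ?_
    rw [← map_smul, MonoidAlgebra.smul_single', mul_one]
  rw [h1, finsum_eq_sum_of_support_subset _ (s := f.coeff.support)]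
  · rw [Finsupp.sum, MonoidAlgebra.coeff_sum, Finsupp.finsetSum_apply]
    refine Finset.sum_congr rfl fun y _ => ?_
    rw [MonoidAlgebra.coeff_smul, Finsupp.smul_apply, smul_eq_mul]
  · intro y hy
    rw [Function.mem_support] at hy
    rw [Finset.mem_coe, Finsupp.mem_support_iff]
    exact fun h => hy (by rw [h, zero_mul])

/-- **Coefficients of a product**: `(T S)_{x,z} = ∑_y S_{y,z} T_{x,y}` for endomorphisms `T`, `S`
of `k[G ⧸ K]`. [folklore] -/
theorem coeff_mul_apply_single_eq_finsum (T S : Module.End k (MonoidAlgebra k (G ⧸ K)))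
    (x z : G ⧸ K) :
    ((T * S) (MonoidAlgebra.single z 1)).coeff x =
      ∑ᶠ y, (S (MonoidAlgebra.single z 1)).coeff y * (T (MonoidAlgebra.single y 1)).coeff x := by
  rw [Module.End.mul_apply, coeff_apply_eq_finsum_coeff_apply_single]

variable {K}

/-- **`G`-invariance of the coefficients** of an element `T` of the Hecke algebra
`ℋ(G, K) = End_G(k[G ⧸ K])`: `T_{g x, g y} = T_{x, y}`. [folklore] -/
theorem coeff_apply_single_smul_of_mem_heckeAlgebra {T : Module.End k (MonoidAlgebra k (G ⧸ K))}
    (hT : T ∈ heckeAlgebra k G K) (g : G) (x y : G ⧸ K) :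
    (T (MonoidAlgebra.single (g • y) 1)).coeff (g • x) = (T (MonoidAlgebra.single y 1)).coeff x := by
  have hg := (mem_heckeAlgebra_iff T).1 hT g
  have h1 : T (MonoidAlgebra.single (g • y) 1) =
      Representation.ofMulAction k G (G ⧸ K) g (T (MonoidAlgebra.single y 1)) := by
    rw [← Representation.ofMulAction_single (k := k) g y 1, ← Module.End.mul_apply, ← hg,
      Module.End.mul_apply]
  rw [h1, Representation.coeff_ofMulAction, inv_smul_smul]

/-- For `T ∈ ℋ(G, K)`: `T_{[a], [b]} = T_{[1], [a⁻¹ b]}` — the kernel of `T` is a function of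
`a⁻¹ b`. [folklore] -/
theorem coeff_apply_single_mk_of_mem_heckeAlgebra {T : Module.End k (MonoidAlgebra k (G ⧸ K))}
    (hT : T ∈ heckeAlgebra k G K) (a b : G) :
    (T (MonoidAlgebra.single (b : G ⧸ K) 1)).coeff (a : G ⧸ K) =
      (T (MonoidAlgebra.single ((a⁻¹ * b : G) : G ⧸ K) 1)).coeff ((1 : G) : G ⧸ K) := by
  rw [← coeff_apply_single_smul_of_mem_heckeAlgebra hT a⁻¹ (a : G ⧸ K) (b : G ⧸ K),
    MulAction.Quotient.smul_coe, MulAction.Quotient.smul_coe, smul_eq_mul, smul_eq_mul,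
    inv_mul_cancel]

/-- **Bi-`K`-invariance**: for `T ∈ ℋ(G, K)` and `k₁, k₂ ∈ K`, `T_{[1], [k₁ g k₂]} = T_{[1], [g]}`.
[folklore] -/
theorem coeff_apply_single_mul_mul_of_mem_heckeAlgebra
    {T : Module.End k (MonoidAlgebra k (G ⧸ K))} (hT : T ∈ heckeAlgebra k G K) {g k₁ k₂ : G}
    (hk₁ : k₁ ∈ K) (hk₂ : k₂ ∈ K) :
    (T (MonoidAlgebra.single ((k₁ * g * k₂ : G) : G ⧸ K) 1)).coeff ((1 : G) : G ⧸ K) =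
      (T (MonoidAlgebra.single (g : G ⧸ K) 1)).coeff ((1 : G) : G ⧸ K) := by
  have h2 : ((k₁ * g * k₂ : G) : G ⧸ K) = ((k₁ * g : G) : G ⧸ K) := by
    rw [QuotientGroup.eq]
    have : (k₁ * g * k₂)⁻¹ * (k₁ * g) = k₂⁻¹ := by group
    rw [this]
    exact K.inv_mem hk₂
  have h1 : ((k₁⁻¹ : G) : G ⧸ K) = ((1 : G) : G ⧸ K) := by
    rw [QuotientGroup.eq, inv_inv, mul_one]
    exact hk₁
  have h3 := coeff_apply_single_mk_of_mem_heckeAlgebra hT k₁⁻¹ g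
  rw [inv_inv, h1] at h3
  rw [h2]
  exact h3.symm

variable (τ : G ≃* Gᵐᵒᵖ)

/-- **Transpose-symmetry of the coefficients.** If `t = unop ∘ τ` is an anti-automorphism of `G`
with `t g ∈ K g K` for all `g`, then for `T ∈ ℋ(G, K)` one has `T_{[a], [b]} = T_{[σ b], [σ a]}`
where `σ g = (t g)⁻¹` (for the transpose: `σ g = ᵗg⁻¹`): the kernel of `T` is a bi-`K`-invariant
function of `a⁻¹ b`, hence fixed by `t` (Bump (1997), proof of Thm. 4.6.1: "these are invariant
under transpose"). [folklore] -/
theorem coeff_apply_single_eq_of_antiInvolution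
    (hcoset : ∀ g : G, ∃ k₁ ∈ K, ∃ k₂ ∈ K, (τ g).unop = k₁ * g * k₂)
    {T : Module.End k (MonoidAlgebra k (G ⧸ K))} (hT : T ∈ heckeAlgebra k G K) (a b : G) :
    (T (MonoidAlgebra.single (b : G ⧸ K) 1)).coeff (a : G ⧸ K) =
      (T (MonoidAlgebra.single ((((τ a).unop)⁻¹ : G) : G ⧸ K) 1)).coeff
        ((((τ b).unop)⁻¹ : G) : G ⧸ K) := by
  rw [coeff_apply_single_mk_of_mem_heckeAlgebra hT a b,
    coeff_apply_single_mk_of_mem_heckeAlgebra hT ((τ b).unop)⁻¹ ((τ a).unop)⁻¹, inv_inv]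
  have h : (τ b).unop * ((τ a).unop)⁻¹ = (τ (a⁻¹ * b)).unop := by
    rw [map_mul, MulOpposite.unop_mul, map_inv, MulOpposite.unop_inv]
  obtain ⟨k₁, hk₁, k₂, hk₂, hab⟩ := hcoset (a⁻¹ * b)
  rw [h, hab, coeff_apply_single_mul_mul_of_mem_heckeAlgebra hT hk₁ hk₂]

/-- **Gelfand's trick** for the Hecke algebra `ℋ(G, K) = End_G(k[G ⧸ K])` of module
`HeckeAlgebra`: if the group `G` admits an anti-involution `t = unop ∘ τ` (`τ : G ≃* Gᵐᵒᵖ`,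
`t ∘ t = id`) with `t(K) ⊆ K` and `t g ∈ K g K` for every `g ∈ G`, then `(G, K)` is a Gelfand pair
over any commutative ring `k`, i.e. `ℋ(G, K)` is commutative.  Proof: the coefficients of
`T ∈ ℋ(G, K)` satisfy `T_{x,y} = T_{σ̄ y, σ̄ x}` for the involution `σ̄` of `G ⧸ K` induced by
`σ = (t ·)⁻¹` (`coeff_apply_single_eq_of_antiInvolution`), whence
`(TS)_{x,z} = ∑_y S_{y,z} T_{x,y} = ∑_y T_{σ̄y,σ̄x} S_{σ̄z,σ̄y} = (ST)_{σ̄z,σ̄x} = (ST)_{x,z}`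
(Bump, *Automorphic Forms and Representations* (1997), Thm. 4.6.1 and proof of Thm. 3.3.3;
Getz–Hahn (2024), Thm. 5.5.1 and Exercise 5.14; Cartier, Corvallis 1979, §IV.1).
[cite: Bump1997, Thm. 4.6.1] -/
theorem IsGelfandPair.of_antiInvolution (hτK : ∀ κ ∈ K, (τ κ).unop ∈ K)
    (hτ2 : ∀ g : G, (τ (τ g).unop).unop = g)
    (hcoset : ∀ g : G, ∃ k₁ ∈ K, ∃ k₂ ∈ K, (τ g).unop = k₁ * g * k₂) :
    IsGelfandPair k G K := by
  classical
  -- the involution `σ g = (t g)⁻¹` of `G` and the induced involution `e` of `G ⧸ K`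
  set σ : G → G := fun g => ((τ g).unop)⁻¹ with hσ
  have hσσ : Function.Involutive σ := fun g => by
    simp only [hσ, map_inv, MulOpposite.unop_inv, inv_inv, hτ2]
  have hrel : ∀ a b : G, a⁻¹ * b ∈ K ↔ (σ a)⁻¹ * σ b ∈ K := by
    intro a b
    have h : (σ a)⁻¹ * σ b = (τ (b⁻¹ * a)).unop := by
      simp only [hσ, inv_inv, map_mul, MulOpposite.unop_mul, map_inv, MulOpposite.unop_inv]
    rw [h]
    constructor
    · intro hab
      have := hτK _ (K.inv_mem hab)
      rwa [_root_.mul_inv_rev, inv_inv] at this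
    · intro hab
      have := K.inv_mem (hτK _ hab)
      rwa [hτ2, _root_.mul_inv_rev, inv_inv] at this
  let e : G ⧸ K ≃ G ⧸ K :=
    Quotient.congr (ra := QuotientGroup.leftRel K) (rb := QuotientGroup.leftRel K) hσσ.toPerm
      fun a b => by
        rw [QuotientGroup.leftRel_apply, QuotientGroup.leftRel_apply]
        exact hrel a b
  have he : ∀ g : G, e (g : G ⧸ K) = ((σ g : G) : G ⧸ K) := fun g =>
    Quotient.congr_mk _ _ g
  -- commutativity, coefficient by coefficient
  intro T S
  obtain ⟨T, hT⟩ := T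
  obtain ⟨S, hS⟩ := S
  have hST : S * T ∈ heckeAlgebra k G K := Subalgebra.mul_mem _ hS hT
  refine Subtype.ext ?_
  change T * S = S * T
  refine MonoidAlgebra.lhom_ext' fun z => LinearMap.ext_ring ?_
  simp only [LinearMap.coe_comp, Function.comp_apply, MonoidAlgebra.lsingle_apply]
  refine MonoidAlgebra.ext (Finsupp.ext fun x => ?_)
  obtain ⟨a, rfl⟩ := QuotientGroup.mk_surjective x
  obtain ⟨c, rfl⟩ := QuotientGroup.mk_surjective z
  rw [coeff_mul_apply_single_eq_finsum, coeff_apply_single_eq_of_antiInvolution τ hcoset hST a c,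
    coeff_mul_apply_single_eq_finsum]
  have key : (fun y : G ⧸ K => (S (MonoidAlgebra.single (c : G ⧸ K) 1)).coeff y *
      (T (MonoidAlgebra.single y 1)).coeff (a : G ⧸ K)) =
      fun y => (fun y' : G ⧸ K => (T (MonoidAlgebra.single ((σ a : G) : G ⧸ K) 1)).coeff y' *
        (S (MonoidAlgebra.single y' 1)).coeff ((σ c : G) : G ⧸ K)) (e y) := by
    funext y
    obtain ⟨b, rfl⟩ := QuotientGroup.mk_surjective y
    rw [he, coeff_apply_single_eq_of_antiInvolution τ hcoset hS b c,
      coeff_apply_single_eq_of_antiInvolution τ hcoset hT a b, mul_comm]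
  rw [key]
  exact finsum_comp_equiv e (f := fun y' : G ⧸ K =>
    (T (MonoidAlgebra.single ((σ a : G) : G ⧸ K) 1)).coeff y' *
      (S (MonoidAlgebra.single y' 1)).coeff ((σ c : G) : G ⧸ K))

end GelfandPair

end Literature.NumberTheory.Automorphic
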